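import Summits.QuantumFields.YangMills.Theorems.LuscherReductionTwistedTraceScalingMehlerHermite
import Literature.Analysis.OperatorTheory.SchurTestKernel
import HarnessLib

/-!
# C4 INNER, brick S (part 2a): the Mehler kernel as a bounded quadratic form on real `L²(ℝ^σ)` — Schur continuity, and its action on the real Hermite functions
# (lane A of S-BASE, crux `TwistedTraceScaling` stmt-QuantumFields-20203; sub-target C4, design note `pub/ym-fleet/ym-luscher-20007-p1/COARSE-DESIGN.md` §21.5 S)

Towards the stiff-sector GAP of the Born–Oppenheimer package (`…InnerBOPackage`): with `K = mehlerKernel a b` (`0 < a_k`, `0 < b_k`, `a_k² + 2a_kb_k = π²`,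
`…MehlerHermite`) and the form `Q(u,w) = ∫∫ u(x) K(x,y) w(y) dy dx` on real square-integrable `u, w`:
* §1 kernel facts: continuity, `K(x,y) ≤ Π_k e^{−a_k y_k²}`, integrable rows, the row bound `∫ K(x,y) dy ≤ M := Π_k √(π/a_k)`;
* §2 product integrability of `K·u(x)²`, `K·w(y)²`, `u(x)·K·w(y)` for `u, w ∈ L²` (Tonelli), hence (Schur, `Literature.Analysis.OperatorTheory.SchurTestKernel`)
  ★ `abs_mehlerForm_le : |Q(u,w)| ≤ M·‖u‖₂‖w‖₂` and the bilinearity of `Q` (`mehlerForm_add_left/right`, `…_smul_…`, `…_sub_…`);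
* §3 the real Hermite functions `hR α = Re h_α` (`h_α` is real-valued): `∫ K(x,y) hR_β(y) dy = λ_β hR_β(x)` (from ★★★ `mehler_herm`), ★ `mehlerForm_hR_right :
  Q(u, hR β) = λ_β ∫ u·hR β`, orthonormality `∫ hR α · hR β = δ_{αβ}`, `Q(hR α, hR β) = λ_β δ_{αβ}` (`λ_β = Π√(π/s_k)·Π(b_k/s_k)^{β_k}`).
Next file (part 2b): the Hermite expansion (`hermiteBasis`) ⇒ `0 ≤ Q(f,f) ≤ λ₀[(1−ρ)(∫f·hR 0)² + ρ‖f‖²]`.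
HONEST FRAMING: classical `L²` bookkeeping for a stub of a child of the CONDITIONAL reduction route (femto rung R2b1); not infinite volume, not a gap, not Clay.

## References
* B. Helffer, *Spectral Theory and its Applications*, CUP 2013, Lemma 7.1 (Schur's test). [Helffer2013]
* G. B. Folland, *Harmonic Analysis in Phase Space*, Princeton UP 1989, §1.7. [Folland1989]
-/

set_option autoImplicit false

open MvPolynomial Complex MeasureTheory
open scoped Real

namespace Summit.QuantumFields.YangMills.Theorems.FemtoTransferGap.Mehler

open Literature.Analysis.SegalBargmann Literature.Analysis.OperatorTheory

noncomputable section

variable {σ : Type*} [Fintype σ] [DecidableEq σ]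

/-! ### §1 Kernel facts -/

omit [DecidableEq σ] in
/-- `K` is jointly continuous. [folklore] -/
theorem continuous_mehlerKernel_uncurry (a b : σ → ℝ) : Continuous fun p : (σ → ℝ) × (σ → ℝ) => mehlerKernel a b p.1 p.2 := by
  unfold mehlerKernel
  fun_prop

omit [DecidableEq σ] in
/-- `K(x, ·)` is continuous. [folklore] -/
theorem continuous_mehlerKernel_right (a b : σ → ℝ) (x : σ → ℝ) : Continuous fun y => mehlerKernel a b x y := by
  unfold mehlerKernel
  fun_prop

omit [DecidableEq σ] in
/-- `K(x,y) ≤ Π_k e^{−a_k y_k²}` for `a, b ≥ 0`. [folklore] -/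
theorem mehlerKernel_le_gauss {a b : σ → ℝ} (ha : ∀ k, 0 ≤ a k) (hb : ∀ k, 0 ≤ b k) (x y : σ → ℝ) :
    mehlerKernel a b x y ≤ ∏ k, Real.exp (-a k * y k ^ 2) := by
  rw [mehlerKernel, ← Real.exp_sum]
  refine Real.exp_le_exp.2 ?_
  rw [← Finset.sum_neg_distrib]
  refine Finset.sum_le_sum fun k _ => ?_
  have h1 : 0 ≤ a k * x k ^ 2 := mul_nonneg (ha k) (sq_nonneg _)
  have h2 : 0 ≤ b k * (x k - y k) ^ 2 := mul_nonneg (hb k) (sq_nonneg _)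
  linarith

omit [DecidableEq σ] in
/-- The Gaussian `Π_k e^{−a_k y_k²}` is integrable with integral `Π_k √(π/a_k)` (`a_k > 0`). [folklore] -/
theorem integral_prod_gauss {a : σ → ℝ} (ha : ∀ k, 0 < a k) :
    Integrable (fun y : σ → ℝ => ∏ k, Real.exp (-a k * y k ^ 2)) ∧ ∫ y : σ → ℝ, ∏ k, Real.exp (-a k * y k ^ 2) = ∏ k, Real.sqrt (π / a k) := by
  refine ⟨Integrable.fintype_prod (fun k => integrable_exp_neg_mul_sq (ha k)), ?_⟩
  rw [integral_fintype_prod_volume_eq_prod (fun k t => Real.exp (-a k * t ^ 2))]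
  exact Finset.prod_congr rfl fun k _ => integral_gaussian (a k)

omit [DecidableEq σ] in
/-- Rows of `K` are integrable (`a_k > 0`, `b_k ≥ 0`). [folklore] -/
theorem integrable_mehlerKernel_right {a b : σ → ℝ} (ha : ∀ k, 0 < a k) (hb : ∀ k, 0 ≤ b k) (x : σ → ℝ) :
    Integrable (fun y => mehlerKernel a b x y) := by
  refine (integral_prod_gauss ha).1.mono' (continuous_mehlerKernel_right a b x).aestronglyMeasurable (ae_of_all _ fun y => ?_)
  rw [Real.norm_eq_abs, abs_of_pos (mehlerKernel_pos a b x y)]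
  exact mehlerKernel_le_gauss (fun k => (ha k).le) hb x y

omit [DecidableEq σ] in
/-- ★ The row bound `∫ K(x,y) dy ≤ M = Π_k √(π/a_k)`. [cite: Helffer2013, Lemma 7.1] -/
theorem integral_mehlerKernel_right_le {a b : σ → ℝ} (ha : ∀ k, 0 < a k) (hb : ∀ k, 0 ≤ b k) (x : σ → ℝ) :
    ∫ y, mehlerKernel a b x y ≤ ∏ k, Real.sqrt (π / a k) := by
  rw [← (integral_prod_gauss ha).2]
  exact integral_mono (integrable_mehlerKernel_right ha hb x) (integral_prod_gauss ha).1
    fun y => mehlerKernel_le_gauss (fun k => (ha k).le) hb x y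

omit [DecidableEq σ] in
/-- `0 ≤ M`. [folklore] -/
theorem rowBound_nonneg (a : σ → ℝ) : 0 ≤ ∏ k, Real.sqrt (π / a k) := Finset.prod_nonneg fun _ _ => Real.sqrt_nonneg _

/-! ### §2 Product integrability and Schur continuity of the form -/

/-- The Mehler quadratic form on real functions: `Q(u,w) = ∫∫ u(x) K(x,y) w(y) dy dx`. [cite: Helffer2013, Lemma 7.1] -/
def mehlerForm (a b : σ → ℝ) (u w : (σ → ℝ) → ℝ) : ℝ := ∫ x, ∫ y, u x * mehlerKernel a b x y * w y

omit [DecidableEq σ] in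
/-- `K(x,y)·u(x)²` is integrable on the product for `u ∈ L²`. [folklore] -/
theorem integrable_mehlerKernel_mul_sq_left {a b : σ → ℝ} (ha : ∀ k, 0 < a k) (hb : ∀ k, 0 ≤ b k) {u : (σ → ℝ) → ℝ} (hu : MemLp u 2) :
    Integrable (fun p : (σ → ℝ) × (σ → ℝ) => mehlerKernel a b p.1 p.2 * u p.1 ^ 2) ((volume : Measure (σ → ℝ)).prod volume) := by
  have hmeas : AEStronglyMeasurable (fun p : (σ → ℝ) × (σ → ℝ) => mehlerKernel a b p.1 p.2 * u p.1 ^ 2) ((volume : Measure (σ → ℝ)).prod volume) :=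
    (continuous_mehlerKernel_uncurry a b).aestronglyMeasurable.mul ((hu.aestronglyMeasurable.comp_fst).pow 2)
  rw [integrable_prod_iff hmeas]
  refine ⟨ae_of_all _ fun x => ?_, ?_⟩
  · simpa using (integrable_mehlerKernel_right ha hb x).mul_const (u x ^ 2)
  have hrow : ∀ x, ∫ y, ‖mehlerKernel a b x y * u x ^ 2‖ = u x ^ 2 * ∫ y, mehlerKernel a b x y := fun x => by
    have : (fun y => ‖mehlerKernel a b x y * u x ^ 2‖) = fun y => mehlerKernel a b x y * u x ^ 2 := by
      funext y; rw [Real.norm_eq_abs, abs_of_nonneg (mul_nonneg (mehlerKernel_pos a b x y).le (sq_nonneg _))]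
    rw [this, integral_mul_const, mul_comm]
  simp_rw [hrow]
  refine ((hu.integrable_sq).mul_const (∏ k, Real.sqrt (π / a k))).mono' ?_ (ae_of_all _ fun x => ?_)
  · exact (hmeas.norm.integral_prod_right').congr (ae_of_all _ fun x => hrow x)
  · rw [Real.norm_eq_abs, abs_of_nonneg (mul_nonneg (sq_nonneg _) (integral_nonneg fun y => (mehlerKernel_pos a b x y).le))]
    exact mul_le_mul_of_nonneg_left (integral_mehlerKernel_right_le ha hb x) (sq_nonneg _)

omit [DecidableEq σ] in
/-- `K(x,y)·w(y)²` is integrable on the product for `w ∈ L²` (symmetry). [folklore] -/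
theorem integrable_mehlerKernel_mul_sq_right {a b : σ → ℝ} (ha : ∀ k, 0 < a k) (hb : ∀ k, 0 ≤ b k) {w : (σ → ℝ) → ℝ} (hw : MemLp w 2) :
    Integrable (fun p : (σ → ℝ) × (σ → ℝ) => mehlerKernel a b p.1 p.2 * w p.2 ^ 2) ((volume : Measure (σ → ℝ)).prod volume) := by
  have h := (integrable_mehlerKernel_mul_sq_left ha hb hw).swap
  refine h.congr (ae_of_all _ fun p => ?_)
  simp only [Function.comp_apply, Prod.fst_swap, Prod.snd_swap]
  rw [mehlerKernel_comm]

omit [DecidableEq σ] in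
/-- `u(x)·K(x,y)·w(y)` is integrable on the product for `u, w ∈ L²`. [folklore] -/
theorem integrable_mehlerForm_integrand {a b : σ → ℝ} (ha : ∀ k, 0 < a k) (hb : ∀ k, 0 ≤ b k) {u w : (σ → ℝ) → ℝ} (hu : MemLp u 2) (hw : MemLp w 2) :
    Integrable (fun p : (σ → ℝ) × (σ → ℝ) => u p.1 * mehlerKernel a b p.1 p.2 * w p.2) ((volume : Measure (σ → ℝ)).prod volume) := by
  have hmeas : AEStronglyMeasurable (fun p : (σ → ℝ) × (σ → ℝ) => u p.1 * mehlerKernel a b p.1 p.2 * w p.2) ((volume : Measure (σ → ℝ)).prod volume) :=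
    (hu.aestronglyMeasurable.comp_fst.mul (continuous_mehlerKernel_uncurry a b).aestronglyMeasurable).mul hw.aestronglyMeasurable.comp_snd
  refine (((integrable_mehlerKernel_mul_sq_left ha hb hu).add (integrable_mehlerKernel_mul_sq_right ha hb hw)).div_const 2).mono' hmeas
    (ae_of_all _ fun p => ?_)
  rw [Real.norm_eq_abs, abs_mul, abs_mul, abs_of_pos (mehlerKernel_pos a b p.1 p.2)]
  have hK := (mehlerKernel_pos a b p.1 p.2).le
  have h2 : 2 * (|u p.1| * |w p.2|) ≤ u p.1 ^ 2 + w p.2 ^ 2 := by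
    rw [← sq_abs (u p.1), ← sq_abs (w p.2)]; nlinarith [sq_nonneg (|u p.1| - |w p.2|)]
  have := mul_le_mul_of_nonneg_left h2 hK
  simp only [Pi.add_apply] at *
  nlinarith

omit [DecidableEq σ] in
/-- The form is the product integral. [folklore] -/
theorem mehlerForm_eq_integral_prod {a b : σ → ℝ} (ha : ∀ k, 0 < a k) (hb : ∀ k, 0 ≤ b k) {u w : (σ → ℝ) → ℝ} (hu : MemLp u 2) (hw : MemLp w 2) :
    mehlerForm a b u w = ∫ p : (σ → ℝ) × (σ → ℝ), u p.1 * mehlerKernel a b p.1 p.2 * w p.2 ∂((volume : Measure (σ → ℝ)).prod volume) := by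
  rw [mehlerForm, integral_prod _ (integrable_mehlerForm_integrand ha hb hu hw)]

omit [DecidableEq σ] in
/-- ★ **Schur continuity**: `Q(u,w) ≤ M·‖u‖₂·‖w‖₂`, `M = Π√(π/a_k)`. [cite: Helffer2013, Lemma 7.1 (7.1.3)] -/
theorem mehlerForm_le {a b : σ → ℝ} (ha : ∀ k, 0 < a k) (hb : ∀ k, 0 ≤ b k) {u w : (σ → ℝ) → ℝ} (hu : MemLp u 2) (hw : MemLp w 2) :
    mehlerForm a b u w ≤ (∏ k, Real.sqrt (π / a k)) * (Real.sqrt (∫ x, u x ^ 2) * Real.sqrt (∫ y, w y ^ 2)) := by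
  have hM := rowBound_nonneg a
  have h := SchurTest.integral_integral_mul_kernel_mul_le_sqrt (μ := (volume : Measure (σ → ℝ))) (ν := (volume : Measure (σ → ℝ)))
    (mehlerKernel a b) u w hM hM (fun x y => (mehlerKernel_pos a b x y).le)
    (ae_of_all _ fun x => integral_mehlerKernel_right_le ha hb x)
    (ae_of_all _ fun y => by simp_rw [mehlerKernel_comm a b _ y]; exact integral_mehlerKernel_right_le ha hb y)
    hu.integrable_sq hw.integrable_sq (integrable_mehlerForm_integrand ha hb hu hw)
    (integrable_mehlerKernel_mul_sq_left ha hb hu) (integrable_mehlerKernel_mul_sq_right ha hb hw)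
  rw [mehlerForm]
  refine h.trans (le_of_eq ?_)
  rw [Real.sqrt_mul_self hM, Real.sqrt_mul (integral_nonneg fun x => sq_nonneg _)]

omit [DecidableEq σ] in
/-- `Q(−u, w) = −Q(u,w)`. [folklore] -/
theorem mehlerForm_neg_left (a b : σ → ℝ) (u w : (σ → ℝ) → ℝ) : mehlerForm a b (fun x => -u x) w = -mehlerForm a b u w := by
  unfold mehlerForm
  rw [← integral_neg]
  congr 1
  funext x
  rw [← integral_neg]
  congr 1
  funext y
  ring

omit [DecidableEq σ] in
/-- ★ `|Q(u,w)| ≤ M·‖u‖₂·‖w‖₂`. [cite: Helffer2013, Lemma 7.1 (7.1.3)] -/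
theorem abs_mehlerForm_le {a b : σ → ℝ} (ha : ∀ k, 0 < a k) (hb : ∀ k, 0 ≤ b k) {u w : (σ → ℝ) → ℝ} (hu : MemLp u 2) (hw : MemLp w 2) :
    |mehlerForm a b u w| ≤ (∏ k, Real.sqrt (π / a k)) * (Real.sqrt (∫ x, u x ^ 2) * Real.sqrt (∫ y, w y ^ 2)) := by
  rw [abs_le]
  refine ⟨?_, mehlerForm_le ha hb hu hw⟩
  have h := mehlerForm_le ha hb hu.neg hw
  have e : mehlerForm a b (-u) w = -mehlerForm a b u w := mehlerForm_neg_left a b u w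
  rw [e] at h
  simp only [Pi.neg_apply, neg_sq] at h
  linarith

omit [DecidableEq σ] in
/-- Additivity in the left slot. [folklore] -/
theorem mehlerForm_add_left {a b : σ → ℝ} (ha : ∀ k, 0 < a k) (hb : ∀ k, 0 ≤ b k) {u u' w : (σ → ℝ) → ℝ} (hu : MemLp u 2) (hu' : MemLp u' 2)
    (hw : MemLp w 2) : mehlerForm a b (u + u') w = mehlerForm a b u w + mehlerForm a b u' w := by
  rw [mehlerForm_eq_integral_prod ha hb (hu.add hu') hw, mehlerForm_eq_integral_prod ha hb hu hw, mehlerForm_eq_integral_prod ha hb hu' hw,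
    ← integral_add (integrable_mehlerForm_integrand ha hb hu hw) (integrable_mehlerForm_integrand ha hb hu' hw)]
  exact integral_congr_ae (ae_of_all _ fun p => by simp only [Pi.add_apply]; ring)

omit [DecidableEq σ] in
/-- Additivity in the right slot. [folklore] -/
theorem mehlerForm_add_right {a b : σ → ℝ} (ha : ∀ k, 0 < a k) (hb : ∀ k, 0 ≤ b k) {u w w' : (σ → ℝ) → ℝ} (hu : MemLp u 2) (hw : MemLp w 2)
    (hw' : MemLp w' 2) : mehlerForm a b u (w + w') = mehlerForm a b u w + mehlerForm a b u w' := by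
  rw [mehlerForm_eq_integral_prod ha hb hu (hw.add hw'), mehlerForm_eq_integral_prod ha hb hu hw, mehlerForm_eq_integral_prod ha hb hu hw',
    ← integral_add (integrable_mehlerForm_integrand ha hb hu hw) (integrable_mehlerForm_integrand ha hb hu hw')]
  exact integral_congr_ae (ae_of_all _ fun p => by simp only [Pi.add_apply]; ring)

omit [DecidableEq σ] in
/-- Homogeneity in the left slot. [folklore] -/
theorem mehlerForm_smul_left (a b : σ → ℝ) (c : ℝ) (u w : (σ → ℝ) → ℝ) : mehlerForm a b (c • u) w = c * mehlerForm a b u w := by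
  unfold mehlerForm
  rw [← integral_const_mul]
  congr 1
  funext x
  rw [← integral_const_mul]
  congr 1
  funext y
  simp only [Pi.smul_apply, smul_eq_mul]
  ring

omit [DecidableEq σ] in
/-- Homogeneity in the right slot. [folklore] -/
theorem mehlerForm_smul_right (a b : σ → ℝ) (c : ℝ) (u w : (σ → ℝ) → ℝ) : mehlerForm a b u (c • w) = c * mehlerForm a b u w := by
  unfold mehlerForm
  rw [← integral_const_mul]
  congr 1
  funext x
  rw [← integral_const_mul]
  congr 1
  funext y
  simp only [Pi.smul_apply, smul_eq_mul]
  ring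

omit [DecidableEq σ] in
/-- Subtraction in both slots: `Q(u,u) − Q(v,v) = Q(u − v, u) + Q(v, u − v)`. [folklore] -/
theorem mehlerForm_self_sub_self {a b : σ → ℝ} (ha : ∀ k, 0 < a k) (hb : ∀ k, 0 ≤ b k) {u v : (σ → ℝ) → ℝ} (hu : MemLp u 2) (hv : MemLp v 2) :
    mehlerForm a b u u - mehlerForm a b v v = mehlerForm a b (u - v) u + mehlerForm a b v (u - v) := by
  have h1 : mehlerForm a b u u = mehlerForm a b (u - v) u + mehlerForm a b v u := by
    rw [← mehlerForm_add_left ha hb (hu.sub hv) hv hu, sub_add_cancel]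
  have h2 : mehlerForm a b v u = mehlerForm a b v (u - v) + mehlerForm a b v v := by
    rw [← mehlerForm_add_right ha hb hv (hu.sub hv) hv, sub_add_cancel]
  rw [h1, h2]; ring

/-! ### §3 The real Hermite functions and the form on them -/

/-- The real Hermite function `hR α = Re h_α` (`h_α` is real-valued). [cite: Folland1989, §1.7] -/
def hR (α : σ →₀ ℕ) (x : σ → ℝ) : ℝ := (hermiteFun (herm α) x).re

/-- `h_α(x) = hR α x` (the Hermite functions are real: `herm α` has real coefficients). [cite: Folland1989, §1.7] -/
theorem hermiteFun_herm_eq_ofReal (α : σ →₀ ℕ) (x : σ → ℝ) : hermiteFun (herm α) x = ((hR α x : ℝ) : ℂ) := by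
  have h : starRingEnd ℂ (hermiteFun (herm α) x) = hermiteFun (herm α) x := by rw [conj_hermiteFun, map_conj_herm]
  rw [hR]
  exact (Complex.conj_eq_iff_re.mp h).symm

/-- `hR α ∈ L²`. [cite: Folland1989, §1.7] -/
theorem memLp_hR (α : σ →₀ ℕ) : MemLp (hR α) 2 (volume : Measure (σ → ℝ)) := (memLp_hermiteFun (herm α)).re

/-- Orthonormality of the real Hermite functions: `∫ hR α · hR β = δ_{αβ}`. [cite: Folland1989, §1.7 (vii)] -/
theorem integral_hR_mul_hR (α β : σ →₀ ℕ) : ∫ x, hR α x * hR β x = if α = β then (1 : ℝ) else 0 := by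
  have h := hermite_orthonormal (σ := σ) α β
  simp_rw [hermiteFun_herm_eq_ofReal, Complex.conj_ofReal, ← Complex.ofReal_mul] at h
  rw [integral_complex_ofReal] at h
  split_ifs at h with hab
  · rw [if_pos hab]; exact_mod_cast h
  · rw [if_neg hab]; exact_mod_cast h

/-- ★ The kernel on a real Hermite function: `∫ K(x,y) hR_β(y) dy = λ_β · hR_β(x)`. [cite: Folland1989, §1.7] -/
theorem integral_mehlerKernel_mul_hR {a b : σ → ℝ} (hs : ∀ k, 0 < a k + b k + π) (hab : ∀ k, a k ^ 2 + 2 * a k * b k = π ^ 2) (β : σ →₀ ℕ) (x : σ → ℝ) :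
    ∫ y, mehlerKernel a b x y * hR β y = ((∏ k, Real.sqrt (π / (a k + b k + π))) * ∏ k, (b k / (a k + b k + π)) ^ (β k)) * hR β x := by
  have h := mehler_herm hs hab β x
  simp_rw [hermiteFun_herm_eq_ofReal, ← Complex.ofReal_mul] at h
  rw [integral_complex_ofReal] at h
  exact_mod_cast h

omit [DecidableEq σ] in
/-- Inner integral of the form: `∫ y, u(x) K(x,y) w(y) dy = u(x) · ∫ y, K(x,y) w(y) dy`. [folklore] -/
theorem integral_inner_eq (a b : σ → ℝ) (u w : (σ → ℝ) → ℝ) (x : σ → ℝ) :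
    ∫ y, u x * mehlerKernel a b x y * w y = u x * ∫ y, mehlerKernel a b x y * w y := by
  rw [← integral_const_mul]
  exact integral_congr_ae (ae_of_all _ fun y => by ring)

/-- ★ `Q(u, hR β) = λ_β · ∫ u · hR β`. [cite: Folland1989, §1.7] -/
theorem mehlerForm_hR_right {a b : σ → ℝ} (hs : ∀ k, 0 < a k + b k + π) (hab : ∀ k, a k ^ 2 + 2 * a k * b k = π ^ 2) (u : (σ → ℝ) → ℝ) (β : σ →₀ ℕ) :
    mehlerForm a b u (hR β) = ((∏ k, Real.sqrt (π / (a k + b k + π))) * ∏ k, (b k / (a k + b k + π)) ^ (β k)) * ∫ x, u x * hR β x := by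
  unfold mehlerForm
  simp_rw [integral_inner_eq, integral_mehlerKernel_mul_hR hs hab]
  rw [← integral_const_mul]
  exact integral_congr_ae (ae_of_all _ fun x => by ring)

/-- `Q(hR α, hR β) = λ_β δ_{αβ}`. [cite: Folland1989, §1.7] -/
theorem mehlerForm_hR_hR {a b : σ → ℝ} (hs : ∀ k, 0 < a k + b k + π) (hab : ∀ k, a k ^ 2 + 2 * a k * b k = π ^ 2) (α β : σ →₀ ℕ) :
    mehlerForm a b (hR α) (hR β) = if α = β then (∏ k, Real.sqrt (π / (a k + b k + π))) * ∏ k, (b k / (a k + b k + π)) ^ (β k) else 0 := by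
  rw [mehlerForm_hR_right hs hab, integral_hR_mul_hR]
  split_ifs <;> simp

end

end Summit.QuantumFields.YangMills.Theorems.FemtoTransferGap.Mehler
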